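import Mathlib
import Summits.AtomisticToContinuum.FouriersLaw.Theses.EmbeddedDrudeMourre
import Summits.AtomisticToContinuum.FouriersLaw.Theorems.EmbeddedDrudeMourreDrudeDissolutionStubExcursionSecondDifferencePlaneSheetFibre
import Summits.AtomisticToContinuum.FouriersLaw.Theorems.EmbeddedDrudeMourreDrudeDissolutionStubExcursionSecondDifferenceSublevelArea
import HarnessLib

/-!
# Geometry of the free pair resonance for stub B1b″ of line `kinetic-polymer-gas-on-the-time-axis`:
# the area of the tube around the co-moving curve of an exchange plane
(crux `EmbeddedDrudeMourre.DrudeDissolution`, item stmt-AtomisticToContinuum-12593; `--supports` file, closes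
nothing; lead c13, geometry input (G-T6b) of the B1b″ discard bound)

WHAT. `area_sublevel_sheetFn_plane_le`: for `ω₂ > 0` there is `C` such that for every `η > 0` the sublevel set of
the plane restriction of the resonant sheet function,
`{(k₁,k₂) ∈ (−π,π]² : |2(ω(k₁)ω(k₂)+ω₂+2)cos((k₁+k₂)/2) − 4cos((k₁−k₂)/2)| < η}`,
has area `≤ Cη` (product of the restricted Lebesgue measures). Since `A = Ω/(S₁S₂)` restricted to the plane
`{k₃ ≡ k₁}` is `2H₀/((ω₁+ω₂)ω₁ω₂)` and `A` is Lipschitz across the plane, the three-dimensional tube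
`{S₁² + A² < η²}` discarded by the second-difference estimate has cell measure `≤ 4πη · C′η = O(η²)`.

HOW. `area_sublevel_le_of_fibre_transversal` with `F = H₀`, `E = ∂H₀/∂k₂` (`sheetFn_plane_hasDerivAt_snd`,
explicit and continuous) and the transversality of every zero (`sheetFn_plane_deriv_snd_ne_zero`).
-/

noncomputable section

open Set Real Topology MeasureTheory
open scoped ENNReal
open Literature.MathematicalPhysics.KineticTheory
open Literature.MathematicalPhysics.KineticTheory.PhononBoltzmann

namespace Summit.AtomisticToContinuum.FouriersLaw.Theorems.DrudeDissolution.KineticPolymerGasOnTheTimeAxis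

/-- **Registered sub-goal `area_sublevel_sheetFn_plane_le` (G-T6b): the tube around the co-moving curve of an
exchange plane has area `O(η)`.** For `ω₂ > 0` there is `C` with
`((vol|(−π,π]).prod (vol|(−π,π])) {q : |2(ω(q.1)ω(q.2)+ω₂+2)cos((q.1+q.2)/2) − 4cos((q.1−q.2)/2)| < η} ≤ Cη`
for all `η > 0`. [folklore] -/
theorem area_sublevel_sheetFn_plane_le :
    ∀ ω₂ : ℝ, 0 < ω₂ → ∃ C : ℝ, ∀ η : ℝ, 0 < η →
      ((volume.restrict (Ioc (-Real.pi) Real.pi)).prod (volume.restrict (Ioc (-Real.pi) Real.pi)))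
        {q : ℝ × ℝ | |2 * (dispersion ω₂ q.1 * dispersion ω₂ q.2 + ω₂ + 2) * Real.cos ((q.1 + q.2) / 2) -
            4 * Real.cos ((q.1 - q.2) / 2)| < η} ≤ ENNReal.ofReal (C * η) := by
  intro ω₂ hω
  have hd : Continuous (dispersion ω₂) :=
    continuous_iff_continuousAt.2 fun k => (hasDerivAt_dispersion hω k).continuousAt
  have hv : Continuous (groupVelocity ω₂) := by
    unfold groupVelocity
    exact Real.continuous_sin.div hd fun k => (dispersion_pos hω k).ne'
  set F : ℝ × ℝ → ℝ := fun q => 2 * (dispersion ω₂ q.1 * dispersion ω₂ q.2 + ω₂ + 2) * Real.cos ((q.1 + q.2) / 2) -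
      4 * Real.cos ((q.1 - q.2) / 2) with hF
  set E : ℝ × ℝ → ℝ := fun q => 2 * dispersion ω₂ q.1 * groupVelocity ω₂ q.2 * Real.cos ((q.1 + q.2) / 2) -
      (dispersion ω₂ q.1 * dispersion ω₂ q.2 + ω₂ + 2) * Real.sin ((q.1 + q.2) / 2) -
      2 * Real.sin ((q.1 - q.2) / 2) with hE
  have c1 : Continuous fun q : ℝ × ℝ => dispersion ω₂ q.1 := hd.comp continuous_fst
  have c2 : Continuous fun q : ℝ × ℝ => dispersion ω₂ q.2 := hd.comp continuous_snd
  have c3 : Continuous fun q : ℝ × ℝ => groupVelocity ω₂ q.2 := hv.comp continuous_snd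
  have hFc : Continuous F := by
    rw [hF]
    exact ((continuous_const.mul (((c1.mul c2).add continuous_const).add continuous_const)).mul
      (by fun_prop)).sub (by fun_prop : Continuous fun q : ℝ × ℝ => 4 * Real.cos ((q.1 - q.2) / 2))
  have hEc : Continuous E := by
    rw [hE]
    exact ((((continuous_const.mul c1).mul c3).mul (by fun_prop)).sub
      ((((c1.mul c2).add continuous_const).add continuous_const).mul (by fun_prop))).sub
      (by fun_prop : Continuous fun q : ℝ × ℝ => 2 * Real.sin ((q.1 - q.2) / 2))
  have hder : ∀ q : ℝ × ℝ, HasDerivAt (fun t : ℝ => F (q.1, t)) (E q) q.2 := fun q => by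
    simp only [hF, hE]
    exact sheetFn_plane_hasDerivAt_snd ω₂ hω q.1 q.2
  have hz : ∀ q : ℝ × ℝ, q ∈ Icc (-Real.pi) Real.pi ×ˢ Icc (-Real.pi) Real.pi → F q = 0 → E q ≠ 0 := fun q _ hq => by
    simp only [hF] at hq
    simp only [hE]
    exact sheetFn_plane_deriv_snd_ne_zero ω₂ hω q.1 q.2 hq
  obtain ⟨C, hC⟩ := area_sublevel_le_of_fibre_transversal F E hFc hEc hder hz
  exact ⟨C, fun η hη => by simpa only [hF] using hC η hη⟩

end Summit.AtomisticToContinuum.FouriersLaw.Theorems.DrudeDissolution.KineticPolymerGasOnTheTimeAxis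

end
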